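import Summits.BirchSwinnertonDyer.BirchSwinnertonDyer.Theorems.ClassRecordThreeCartanOnePlaceDegreeLawAtThreeSheetIndex
import Literature.NumberTheory.Automorphic.FundamentalDomainFiniteIndexUnfolding
import Literature.NumberTheory.Automorphic.FundamentalDomainCosetUnfolding
import HarnessLib

/-!
# Crux NUM `CartanOnePlaceDegreeLawAtThree` (item 24801) — (SHEET): finite unfolding of the
# component-summed Petersson norm of a docked vector

Seat `bsd-stepL-tam3-p1` g30 (LEAD of 24801; `--supports` 24801). PROVES the analytic statement
`(SHEET)` of the `petarea` cut of the print conjunct `(PET)` (`Cruxes/…/Lines/petarea.lean`,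
`def SheetUnfolding`) VERBATIM (`sheetUnfolding` below; `stub_sheetUnfolding := sheetUnfolding`):
for `T ≤ GL₂(𝔽_q)` containing `−1`, `F ∈ S₂(Γ_T)`, `a ∈ ℂ`, fundamental domains `Fq` of `Γ̄(q)` and `FT` of `Γ_T`,
`c · Σ_{g ∈ GL₂(𝔽_q)} ∫⁻_{Fq} ‖(a • R.dockTorus T F)_g‖² y² = |H|·|T|·|a|²·∫⁻_{FT} ‖F‖² y²`, `H = redHom(ι(O₀'¹))`,
`c = 1` if `−1 ∈ Γ̄(q)` else `2`.

Proof: the component at `g ∈ H·T` is `F ∣₂ γ⁻¹` (`dockTorus_apply_of_witness`), elsewhere `0`;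
`‖(F ∣₂ γ⁻¹)(τ)‖² (Im τ)² = Φ(γ⁻¹τ)` with `Φ = ‖F‖² y²` (`norm_slash_two_mul_im`, `pet_slash`); `∫⁻_{Fq} Φ ∘ γ⁻¹ = ∫⁻_{γ⁻¹Fq} Φ`
(invariance of `μ_hyp`); `γ⁻¹Fq` is a `Γ̄(q)`-, hence `Γ̄(q){±1}`-domain (`conjAct_smul_principalLevel`); the general
finite-index unfolding `∫⁻_{γ⁻¹Fq} Φ = [Γ_T : Γ̄(q){±1}] ∫⁻_{FT} Φ` (`setLIntegral_eq_relIndex_mul_setLIntegral`, Φ is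
`Γ_T`-invariant); finally `c · [Γ_T : Γ̄(q){±1}] = |H ∩ T|` and `|H·T| · |H ∩ T| = |H| · |T|` (`…SheetIndex`).
Nothing about degrees or any curve; BSD is proved for no curve.
[cite: Iwaniec2002, §2.2–2.4] [cite: ShimuraIATAF1971, §2.1 and Prop. 3.36] [cite: KohenPacetti2016, §2]
-/

set_option linter.dupNamespace false
set_option autoImplicit false

noncomputable section

open scoped Classical Pointwise MatrixGroups ModularForm ENNReal UpperHalfPlane
open MeasureTheory ConjAct Matrix

namespace Summit.BirchSwinnertonDyer.BirchSwinnertonDyer.Theorems.CartanCover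

open Literature.NumberTheory.Automorphic Literature.NumberTheory.EllipticCurves.ModularForms

/-- **`‖(f ∣₂ a)(τ)‖ · Im τ = ‖f(aτ)‖ · Im(aτ)`** for `det a > 0`. [folklore] -/
theorem norm_slash_two_mul_im {a : GL (Fin 2) ℝ} (ha : 0 < a.det.val) (f : ℍ → ℂ) (τ : ℍ) :
    ‖(f ∣[(2 : ℤ)] a) τ‖ * τ.im = ‖f (a • τ)‖ * (a • τ).im := by
  have hd : UpperHalfPlane.denom a τ ≠ 0 := UpperHalfPlane.denom_ne_zero a τ
  have hN : Complex.normSq (UpperHalfPlane.denom a τ) = ‖UpperHalfPlane.denom a τ‖ ^ 2 := by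
    rw [Complex.normSq_eq_norm_sq]
  have hn0 : 0 < ‖UpperHalfPlane.denom a τ‖ := norm_pos_iff.mpr hd
  rw [ModularForm.slash_apply, norm_mul, norm_mul, UpperHalfPlane.norm_σ, UpperHalfPlane.im_smul_eq_div_normSq, hN,
    abs_of_pos ha, show (2 : ℤ) - 1 = 1 by norm_num, zpow_one, Complex.norm_real, Real.norm_of_nonneg ha.le,
    norm_zpow, _root_.zpow_neg, zpow_ofNat]
  field_simp

/-- The Petersson integrand `Φ_F(τ) = ‖F τ‖² (Im τ)²` (in `ℝ≥0∞`) is measurable for continuous `F`. -/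
theorem measurable_pet {F : ℍ → ℂ} (hF : Continuous F) :
    Measurable fun τ : ℍ => ENNReal.ofReal (‖F τ‖ ^ 2 * τ.im ^ 2) :=
  ENNReal.measurable_ofReal.comp
    (((continuous_norm.comp hF).pow 2).mul (UpperHalfPlane.continuous_im.pow 2)).measurable

/-- `Φ_{F ∣ a}(τ) = Φ_F(aτ)` for `det a > 0`. -/
theorem pet_slash {a : GL (Fin 2) ℝ} (ha : 0 < a.det.val) (F : ℍ → ℂ) (τ : ℍ) :
    ENNReal.ofReal (‖(F ∣[(2 : ℤ)] a) τ‖ ^ 2 * τ.im ^ 2) = ENNReal.ofReal (‖F (a • τ)‖ ^ 2 * (a • τ).im ^ 2) := by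
  rw [show ‖(F ∣[(2 : ℤ)] a) τ‖ ^ 2 * τ.im ^ 2 = (‖(F ∣[(2 : ℤ)] a) τ‖ * τ.im) ^ 2 by ring,
    norm_slash_two_mul_im ha, mul_pow]

/-- `Φ_F` is `Γ`-invariant for `F ∈ S₂(Γ)` when `Γ` has determinant one. -/
theorem pet_smul_of_mem {Γ : Subgroup (GL (Fin 2) ℝ)} [Γ.HasDetOne] (F : CuspForm Γ 2) {γ : GL (Fin 2) ℝ}
    (hγ : γ ∈ Γ) (τ : ℍ) :
    ENNReal.ofReal (‖F (γ • τ)‖ ^ 2 * (γ • τ).im ^ 2) = ENNReal.ofReal (‖F τ‖ ^ 2 * τ.im ^ 2) := by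
  have hdet : 0 < γ.det.val := by
    have h : γ.det = 1 := Subgroup.HasDetOne.det_eq hγ
    rw [h, Units.val_one]; exact one_pos
  rw [← pet_slash hdet, SlashInvariantForm.slash_action_eqn F γ hγ]

variable {D M : ℕ} {C : Finset ℕ} {X : CartanLevelCurveData D M C} {q : ℕ}

namespace CoverReduction

variable [Fact q.Prime] (R : CoverReduction X q)

/-- `Γ_T` has determinant one. -/
theorem hasDetOne_levelOf (T : Subgroup (GL (Fin 2) (ZMod q))) : (R.levelOf T).HasDetOne :=
  ⟨fun {g} hg => (R.levelOf_le_range_toGL T hg).elim fun s hs => by rw [← hs]; simp⟩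

/-- **The integral of one docked component**: for `g = redHom(γ)·t ∈ H·T`,
`∫⁻_{Fq} Φ_{(dockTorus T F)_g} = [Γ_T : Γ̄(q){±1}] · ∫⁻_{FT} Φ_F`. -/
theorem setLIntegral_pet_dockTorus_of_witness (T : Subgroup (GL (Fin 2) (ZMod q))) (hT : (-1 : GL (Fin 2) (ZMod q)) ∈ T)
    (F : CuspForm (R.levelOf T) 2) {Fq FT : Set ℍ} (hFq : IsHypFundamentalDomain (principalLevel X q) Fq)
    (hFT : IsHypFundamentalDomain (R.levelOf T) FT) {g : GL (Fin 2) (ZMod q)} {γ : coverUnits X q}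
    (hg : (R.redHom γ)⁻¹ * g ∈ T) :
    ∫⁻ τ in Fq, ENNReal.ofReal (‖((R.dockTorus T F).1 g) τ‖ ^ 2 * τ.im ^ 2) =
      (((principalLevel X q).adjoinNegOne).relIndex (R.levelOf T) : ℝ≥0∞) *
        ∫⁻ τ in FT, ENNReal.ofReal (‖F τ‖ ^ 2 * τ.im ^ 2) := by
  haveI := R.hasDetOne_levelOf T
  haveI := R.finiteIndex_adjoinNegOne_subgroupOf_levelOf T hT
  -- the component is `F ∣₂ γ⁻¹`
  have hcomp : ⇑((R.dockTorus T F).1 g) = ⇑F ∣[(2 : ℤ)] ((γ : GL (Fin 2) ℝ))⁻¹ := by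
    rw [R.dockTorus_apply_of_witness T F hg, coverRep_apply, coe_coverSlash, coe_restrictLevel]
  have hγinv : ((γ : GL (Fin 2) ℝ))⁻¹ ∈ coverUnits X q := (coverUnits X q).inv_mem γ.2
  have hdet : 0 < (((γ : GL (Fin 2) ℝ))⁻¹).det.val := det_pos_of_mem_coverUnits X q hγinv
  simp_rw [hcomp, pet_slash hdet]
  -- change of variables `τ ↦ γ⁻¹ τ`
  have hmp : MeasurePreserving (fun τ : ℍ => ((γ : GL (Fin 2) ℝ))⁻¹ • τ) volume volume :=
    measurePreserving_smul _ _
  have hpre : (fun τ : ℍ => ((γ : GL (Fin 2) ℝ))⁻¹ • τ) ⁻¹' (((γ : GL (Fin 2) ℝ))⁻¹ • Fq) = Fq := by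
    rw [Set.preimage_smul, inv_inv, smul_inv_smul]
  have hcv := hmp.setLIntegral_comp_preimage_emb (measurableEmbedding_const_smul _)
    (fun τ : ℍ => ENNReal.ofReal (‖F τ‖ ^ 2 * τ.im ^ 2)) (((γ : GL (Fin 2) ℝ))⁻¹ • Fq)
  rw [hpre] at hcv
  rw [hcv]
  -- `γ⁻¹ Fq` is a `Γ̄(q){±1}`-domain; unfold over `Γ_T`
  have hF₁ : IsHypFundamentalDomain (principalLevel X q) (((γ : GL (Fin 2) ℝ))⁻¹ • Fq) := by
    have h := hFq.conjAct_inv_smul (γ : GL (Fin 2) ℝ)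
    rwa [conjAct_smul_principalLevel X q hγinv] at h
  exact setLIntegral_eq_relIndex_mul_setLIntegral (R.levelOf_le_range_toGL T) (R.countable_levelOf T) hFT
    (R.adjoinNegOne_principalLevel_le_levelOf T hT) (Subgroup.negOne_mem_adjoinNegOne _) hF₁.adjoinNegOne
    (measurable_pet F.holo'.continuous) (fun γ' hγ' w => pet_smul_of_mem F hγ' w)

/-- **(SHEET)** — the statement `Cruxes.CartanOnePlaceDegreeLawAtThree.Petarea.SheetUnfolding` verbatim.
[cite: Iwaniec2002, §2.2–2.4] [cite: ShimuraIATAF1971, §2.1 and Prop. 3.36] -/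
theorem sheetUnfolding :
    ∀ {D M : ℕ} {C : Finset ℕ} {X : CartanLevelCurveData D M C} {q : ℕ} [Fact q.Prime] (R : CoverReduction X q)
      (T : Subgroup (GL (Fin 2) (ZMod q))) (F : CuspForm (R.levelOf T) 2) (a : ℂ) (Fq FT : Set ℍ),
      IsHypFundamentalDomain (principalLevel X q) Fq → IsHypFundamentalDomain (R.levelOf T) FT → (-1 : GL (Fin 2) (ZMod q)) ∈ T →
        ((if (-1 : GL (Fin 2) ℝ) ∈ principalLevel X q then 1 else 2 : ℕ) : ℝ≥0∞) *
            ∑ g : GL (Fin 2) (ZMod q), ∫⁻ τ in Fq, ENNReal.ofReal (‖((a • R.dockTorus T F).1 g) τ‖ ^ 2 * τ.im ^ 2) =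
          (Nat.card R.redHom.range : ℝ≥0∞) * (Nat.card T : ℝ≥0∞) * ENNReal.ofReal (‖a‖ ^ 2) *
            ∫⁻ τ in FT, ENNReal.ofReal (‖F τ‖ ^ 2 * τ.im ^ 2) := by
  intro D M C X q _ R T F a Fq FT hFq hFT hT
  -- pull out `|a|²`
  have hsm : ∀ (g : GL (Fin 2) (ZMod q)) (τ : ℍ),
      ENNReal.ofReal (‖((a • R.dockTorus T F).1 g) τ‖ ^ 2 * τ.im ^ 2) =
        ENNReal.ofReal (‖a‖ ^ 2) * ENNReal.ofReal (‖((R.dockTorus T F).1 g) τ‖ ^ 2 * τ.im ^ 2) := by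
    intro g τ
    have e : ((a • R.dockTorus T F).1 g) τ = a * ((R.dockTorus T F).1 g) τ := by
      change ((a • (R.dockTorus T F).1) g) τ = _
      rw [Pi.smul_apply, CuspForm.IsGLPos.smul_apply, smul_eq_mul]
    rw [e, norm_mul, mul_pow, mul_assoc, ENNReal.ofReal_mul (sq_nonneg _)]
  simp_rw [hsm]
  have ha_top : ENNReal.ofReal (‖a‖ ^ 2) ≠ ⊤ := ENNReal.ofReal_ne_top
  simp_rw [lintegral_const_mul' _ _ ha_top]
  rw [← Finset.mul_sum]
  -- each component integral
  set I : ℝ≥0∞ := (((principalLevel X q).adjoinNegOne).relIndex (R.levelOf T) : ℝ≥0∞) *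
    ∫⁻ τ in FT, ENNReal.ofReal (‖F τ‖ ^ 2 * τ.im ^ 2) with hI
  have hterm : ∀ g : GL (Fin 2) (ZMod q),
      ∫⁻ τ in Fq, ENNReal.ofReal (‖((R.dockTorus T F).1 g) τ‖ ^ 2 * τ.im ^ 2) =
        if g ∈ R.torusCoset T then I else 0 := by
    intro g
    by_cases hg : g ∈ R.torusCoset T
    · rw [if_pos hg]
      obtain ⟨γ, hγ⟩ := (R.mem_torusCoset_iff T g).mp hg
      exact R.setLIntegral_pet_dockTorus_of_witness T hT F hFq hFT hγ
    · rw [if_neg hg, R.dockTorus_apply_of_not T F hg]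
      simp
  simp_rw [hterm]
  rw [Finset.sum_ite, Finset.sum_const_zero, add_zero, Finset.sum_const, nsmul_eq_mul]
  -- the counting identities
  have hN : ((Finset.univ.filter fun g : GL (Fin 2) (ZMod q) => g ∈ R.torusCoset T).card : ℕ) =
      ∑ g : GL (Fin 2) (ZMod q), (if g ∈ R.torusCoset T then 1 else 0) := by
    rw [Finset.sum_boole]; simp
  have h1 := R.sum_ite_mem_torusCoset T            -- N * n = |H| * |T|
  have h2 := R.ite_mul_relIndex_adjoinNegOne_levelOf T hT   -- c * r = n
  rw [← hN] at h1
  -- assemble in `ℝ≥0∞`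
  set N : ℕ := (Finset.univ.filter fun g : GL (Fin 2) (ZMod q) => g ∈ R.torusCoset T).card with hNdef
  set c : ℕ := (if (-1 : GL (Fin 2) ℝ) ∈ principalLevel X q then 1 else 2) with hc
  set r : ℕ := ((principalLevel X q).adjoinNegOne).relIndex (R.levelOf T) with hr
  set n : ℕ := Nat.card ↥(R.redHom.range ⊓ T) with hn
  have key : (c : ℝ≥0∞) * ((N : ℝ≥0∞) * (r : ℝ≥0∞)) = (Nat.card R.redHom.range : ℝ≥0∞) * (Nat.card T : ℝ≥0∞) := by
    have e : c * (N * r) = Nat.card R.redHom.range * Nat.card T := by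
      rw [mul_left_comm, h2, h1]
    exact_mod_cast e
  rw [hI]
  calc (c : ℝ≥0∞) * (ENNReal.ofReal (‖a‖ ^ 2) * ((N : ℝ≥0∞) * ((r : ℝ≥0∞) *
        ∫⁻ τ in FT, ENNReal.ofReal (‖F τ‖ ^ 2 * τ.im ^ 2))))
      = ((c : ℝ≥0∞) * ((N : ℝ≥0∞) * (r : ℝ≥0∞))) * ENNReal.ofReal (‖a‖ ^ 2) *
          ∫⁻ τ in FT, ENNReal.ofReal (‖F τ‖ ^ 2 * τ.im ^ 2) := by ring
    _ = (Nat.card R.redHom.range : ℝ≥0∞) * (Nat.card T : ℝ≥0∞) * ENNReal.ofReal (‖a‖ ^ 2) *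
          ∫⁻ τ in FT, ENNReal.ofReal (‖F τ‖ ^ 2 * τ.im ^ 2) := by rw [key]

end CoverReduction

end Summit.BirchSwinnertonDyer.BirchSwinnertonDyer.Theorems.CartanCover

end
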